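import Summits.BirchSwinnertonDyer.BirchSwinnertonDyer.Theses.UniversalToricDescent
import Summits.BirchSwinnertonDyer.BirchSwinnertonDyer.Theorems.UniversalToricDescentThinCombDefs
import Summits.BirchSwinnertonDyer.BirchSwinnertonDyer.Theorems.UniversalToricDescentAdditiveSplitIMCInclusionAtThreeStubFrame
import Summits.BirchSwinnertonDyer.BirchSwinnertonDyer.Theorems.UniversalToricDescentAdditiveSplitIMCInclusionAtThreeStubCharIdealPrincipal
import Summits.BirchSwinnertonDyer.BirchSwinnertonDyer.Theorems.UniversalToricDescentAdditiveSplitIMCInclusionAtThreeStubWeakRigidity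
import Summits.BirchSwinnertonDyer.BirchSwinnertonDyer.Theorems.UniversalToricDescentAdditiveSplitIMCInclusionAtThreeStubDescent
import Summits.BirchSwinnertonDyer.BirchSwinnertonDyer.Theorems.UniversalToricDescentThinCombLineValue
import Summits.BirchSwinnertonDyer.BirchSwinnertonDyer.Theorems.SignedBaseChangeAnticyclotomicEisensteinDivisibilityXGrTwoModuleFinite
import Literature.NumberTheory.EllipticCurves.TwoVariableSelmerDual
import Literature.NumberTheory.EllipticCurves.ZpExtensionSplitPrimeLineThroughPair
import Literature.NumberTheory.EllipticCurves.ToricTwoVariablePAdicLFunction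
import Summits.BirchSwinnertonDyer.BirchSwinnertonDyer.Theorems.UniversalToricDescentBDPFrameCrossPeriodRigidity
import Summits.BirchSwinnertonDyer.BirchSwinnertonDyer.Theorems.UniversalToricDescentThinCombContRigidity
import Summits.BirchSwinnertonDyer.BirchSwinnertonDyer.Theorems.UniversalToricDescentCharIdealVacuity
import Summits.BirchSwinnertonDyer.BirchSwinnertonDyer.Theorems.UniversalToricDescentAdditiveSplitIMCInclusionAtThreeStubTorsionTransfer
import HarnessLib

/-!
# Line `nakayama_anchor` — crux `AdditiveSplitIMCInclusionAtThree` (stmt-BirchSwinnertonDyer-20395, THE WALL, UTD)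
# NODE of crux idea `nakayama-anchor` (cruxidea-stmt-BirchSwinnertonDyer-20395-1 gen4, 2026-08-30).

THE LEVER (two sentences).  In the two-variable frame of `thin_comb` v8.1 the wall asks for the KOLYVAGIN direction
`G ∣ L₂` (`G = char_{Λ₂} X₂`, `L₂` the toric two-variable `𝔭`-adic `L`-function); every live card of this crux tries to
prove an UPPER bound for a Selmer group ON THE ANTICYCLOTOMIC SIDE of the supercuspidal prime `3`, where no Euler
system survives (barriers `TraceZeroHeegnerTowerAtAdditiveSplitP`, `NoAdmissiblePrimesAtThree`, cone K2(b-val)).  This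
line never does: it takes the EISENSTEIN direction `L₂ ∣ G` in the family (`stub_twoVarEisenstein` — the native
two-variable output of the semi-ordinary `U(3,1)` engine behind SOED's `WildSplitEisensteinInclusionAtThree`, shared) and ONE
ANCHOR — association of `G` and `L₂` on a single proper quotient `Λ₂/𝔮` on which `L₂` stays a non-zero-divisor
(`stub_cyclotomicAnchor`; intended `𝔮 = 𝔠` = the CYCLOTOMIC line of the frame, where KATO's Euler system of `f_E` and
`f_E ⊗ ε_K` exists integrally at every level, additive `3` included) — and detects the unit `G/L₂ ∈ Λ₂ˣ` by Nakayama in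
the LOCAL ring `Λ₂(R₀) = R₀⟦T₂⟧⟦T₁⟧` (`dvd_of_dvd_of_anchor`, PROVED below = Skinner–Urban 2014 Lem. 3.1.7 in
non-zero-divisor form).  Then `hdvd : G ∣ L₂` feeds the LANDED descent `…ThinCombLine.stub_descent` verbatim.

WHY NOVEL (one sentence).  None of the 13 cards / 3 skeletons of this crux touches the cyclotomic direction or Kato's
zeta elements: the Kolyvagin direction on the anticyclotomic line at a supercuspidal prime is here INHERITED from the
cyclotomic line through the local ring `Λ_K`, the two-variable Eisenstein divisibility being the rigid object that links
the two lines (nearest print: Burungale–Castella–Skinner arXiv:2405.00270 §5, good ORDINARY `p`, where each line still has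
its own Euler system and [SU14, Lem. 3.1.7] is applied with the ANTICYCLOTOMIC line as anchor — the opposite way).

PIECES (tags per the NODE contract):
* `stub_toricExists` — VERBATIM `thin_comb` v8.1 K3a (PRINT-ADJACENT · ATTACKABLE; Hida 1988 ⊗ Castella–Wan 2.11).
* `stub_twoVarEisenstein` — E₂: `L₂ ∣ G` in `Λ₂(R₀)` (UNDECIDED, incomparable with the crux; RESEARCH at supercuspidal
  `3`, = SOED stmt-…-20479 in native two-variable form; leaves: IDEA-NEEDED «p-integral Fourier–Jacobi / period comparison at
  `p = 3`» (BCS24 p. 5: Wan15's `p > 3` is «only for a comparison of automorphic periods»), BARRIER-adjacent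
  `EisensteinMuConjecture` for the `μ`-part).
* `stub_cyclotomicAnchor` — A: `∃ 𝔮 ≠ ⊥, ⊤` with `L₂ mod 𝔮` regular and `G ≡ L₂ · unit (mod 𝔮)` (UNDECIDED, incomparable;
  WEAKER than the two-variable IMC; leaves: A-ctrl cyclotomic control of `X₂` at `𝔠` (ATTACKABLE), A-PT Poitou–Tate
  four-term bookkeeping on `K_cyc` (ATTACKABLE/INSTRUMENTABLE), A-Kato Kato 2004 Thm. 12.5/17.4 divisibility for `f_E`,
  `f_E ⊗ ε_K` over `ℚ_cyc` at `p = 3` (PRINT for 3-adically big image; BARRIER `EulerSystemBigImageAtSmallImage` on the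
  onto-mod-3-not-mod-9 rows), A-ε the identity (I) `π_𝔠(L₂) ∼ ε-wedge(loc₃ z(f_E) ∧ loc₃ z(f_E^K))` (IDEA-NEEDED — the
  research kernel; ordinary analogue = CGS23 Prop. 1.2.4 + Perrin-Riou; two attack routes on the card)).
* `stub_noPseudoNull` — VERBATIM `thin_comb` v8.1 (WEAKER · ATTACKABLE; closed modulo Milne ADT I 4.10 (a) in tree).
* `isUnit_of_isUnit_mk`, `associated_of_dvd_of_anchor`, `dvd_of_dvd_of_anchor` — PROVED (no sorry).
* `AdditiveSplitIMCInclusionAtThree_of` — kernel-checked composition concluding the crux BY NAME; `thin_comb` v8.1 `_of`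
  with the `stub_combDivisibility`/`stub_weakRigidity` lines replaced by E₂ + A + Nakayama; sorries ONLY in `stub_*`.
COSTUME CHECK: no stub restates the crux (one-variable `span L ≤ char.map`), the summit, or a negatives entry (15532, 24881
unrelated); `𝔮 = ⊥` (which would make A the two-variable IMC itself) is excluded syntactically; `L₂ = 0` is excluded in
E₂ and A (else `0 ∣ G` would misstate E₂) and handled in `_of` by `span {0} = ⊥`.
-/

set_option linter.dupNamespace false
set_option autoImplicit false

noncomputable section

open NumberField IsDedekindDomain Field
open Literature.NumberTheory.EllipticCurves Literature.NumberTheory.GaloisRepresentations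
open Summit.BirchSwinnertonDyer.BirchSwinnertonDyer.Theorems.UniversalToricDescentThinComb

namespace Summit.BirchSwinnertonDyer.BirchSwinnertonDyer.Cruxes.AdditiveSplitIMCInclusionAtThree.NakayamaAnchor

/-! ## The anchor algebra (PROVED) — Skinner–Urban, Invent. Math. 195 (2014), Lemma 3.1.7, non-zero-divisor form -/

section Anchor

variable {R : Type*} [CommRing R] [IsLocalRing R]

/-- In a local ring, an element that becomes a unit modulo a proper ideal is a unit. -/
theorem isUnit_of_isUnit_mk {𝔮 : Ideal R} (h𝔮 : 𝔮 ≠ ⊤) {h : R}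
    (hu : IsUnit (Ideal.Quotient.mk 𝔮 h)) : IsUnit h := by
  by_contra hh
  have hmem : h ∈ IsLocalRing.maximalIdeal R := (IsLocalRing.mem_maximalIdeal h).mpr hh
  have hle : 𝔮 ≤ IsLocalRing.maximalIdeal R := IsLocalRing.le_maximalIdeal h𝔮
  obtain ⟨v, hv⟩ := hu.exists_right_inv
  obtain ⟨w, rfl⟩ := Ideal.Quotient.mk_surjective v
  have h1 : Ideal.Quotient.mk 𝔮 (h * w - 1) = 0 := by
    simp [map_sub, map_mul, hv]
  have h2 : h * w - 1 ∈ IsLocalRing.maximalIdeal R := hle (Ideal.Quotient.eq_zero_iff_mem.mp h1)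
  have h3 : h * w ∈ IsLocalRing.maximalIdeal R := Ideal.mul_mem_right w _ hmem
  have h4 : (1 : R) ∈ IsLocalRing.maximalIdeal R := by
    simpa using Ideal.sub_mem _ h3 h2
  exact (IsLocalRing.maximalIdeal.isMaximal R).ne_top (Ideal.eq_top_of_isUnit_mem _ h4 isUnit_one)

/-- **Anchor lemma.** In a local ring: `L ∣ G`, and modulo a proper ideal `𝔮` the image of `L` is a non-zero-divisor
associated with the image of `G` ⟹ `G` and `L` are associated. [cite: SkinnerUrban2014, Lemma 3.1.7 (store p0020)] -/
theorem associated_of_dvd_of_anchor {𝔮 : Ideal R} (h𝔮 : 𝔮 ≠ ⊤) {G L : R} (hE : L ∣ G)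
    (hreg : Ideal.Quotient.mk 𝔮 L ∈ nonZeroDivisors (R ⧸ 𝔮))
    (hA : Associated (Ideal.Quotient.mk 𝔮 G) (Ideal.Quotient.mk 𝔮 L)) : Associated G L := by
  obtain ⟨h, rfl⟩ := hE
  obtain ⟨u, hu⟩ := hA
  have hzero : (Ideal.Quotient.mk 𝔮 h * (u : R ⧸ 𝔮) - 1) * Ideal.Quotient.mk 𝔮 L = 0 := by
    have : Ideal.Quotient.mk 𝔮 (L * h) * (u : R ⧸ 𝔮) = Ideal.Quotient.mk 𝔮 L := hu
    rw [map_mul] at this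
    linear_combination this
  have hone : Ideal.Quotient.mk 𝔮 h * (u : R ⧸ 𝔮) = 1 :=
    sub_eq_zero.mp ((mem_nonZeroDivisors_iff.mp hreg).2 _ hzero)
  have hunit : IsUnit (Ideal.Quotient.mk 𝔮 h) := isUnit_iff_exists_inv.mpr ⟨_, hone⟩
  exact associated_mul_unit_left L h (isUnit_of_isUnit_mk h𝔮 hunit)

/-- The reverse divisibility the descent consumes. -/
theorem dvd_of_dvd_of_anchor {𝔮 : Ideal R} (h𝔮 : 𝔮 ≠ ⊤) {G L : R} (hE : L ∣ G)
    (hreg : Ideal.Quotient.mk 𝔮 L ∈ nonZeroDivisors (R ⧸ 𝔮))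
    (hA : Associated (Ideal.Quotient.mk 𝔮 G) (Ideal.Quotient.mk 𝔮 L)) : G ∣ L :=
  (associated_of_dvd_of_anchor h𝔮 hE hreg hA).dvd

end Anchor

/-! ## Registered stubs -/

/-- **K3a `stub_toricExists`** — VERBATIM from `Lines/thin_comb.lean` v8.1 (PRINT-ADJACENT · ATTACKABLE): in a v2 frame a
two-variable toric `𝔭`-adic `L`-function `L₂ ∈ Λ₂(R₀)` of `f = Dt.f` exists at SOME admissible period pair.
[cite: CastellaWan2023, §2.4 Thm. 2.11 (arXiv:1607.02019)] [cite: Hida1988AIF, §5 Thm. 5.1b (doi:10.5802/aif.1141)]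
Why it might fail at three: Hida 1988 carries `p ≥ 5` (ordinary Λ-adic duality); the `p = 3` case is an unwritten
adaptation (see `K3A-PRINT-STATUS-g4.md`). -/
theorem stub_toricExists :
    ∀ (W : WeierstrassCurve ℚ) [W.IsElliptic] [W.IsGloballyMinimal] (N : ℕ) [NeZero N] (K : Type) [Field K]
      [NumberField K] (Dt : Literature.NumberTheory.EllipticCurves.ModularForms.ModularParametrizationData W N),
    Summit.BirchSwinnertonDyer.Rank1Residual.Additive.ClassO6 W 3 → W.HasSurjectiveModNGaloisRep 3 →
    W.analyticRank = 1 → W.conductorNorm ℤ = N → IsImaginaryQuadratic K → SatisfiesHeegnerHypothesis N K →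
    ∀ (κ : ZpExtension K 3), κ.IsAnticyclotomic → ∀ (γ : Field.absoluteGaloisGroup K) [Fact (κ.IsTopGenerator γ)]
      (𝔭 : HeightOneSpectrum (𝓞 K)), ((3 : ℕ) : 𝓞 K) ∈ 𝔭.asIdeal →
      𝔭.asIdeal.ramificationIdx (𝓞 ℚ) = 1 → 𝔭.asIdeal.inertiaDeg (𝓞 ℚ) = 1 →
    ∀ (𝔭' : HeightOneSpectrum (𝓞 K)), ((3 : ℕ) : 𝓞 K) ∈ 𝔭'.asIdeal → 𝔭' ≠ 𝔭 →
    ∀ (ι' : PadicAlgCl 3 ≃+* ℂ), Summit.BirchSwinnertonDyer.BirchSwinnertonDyer.Theorems.SchneiderFree.BranchInducesPrime 3 ι' 𝔭 →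
    ∀ (κ₁ κ₂ : ZpExtension K 3) (γ₁ γ₂ : Field.absoluteGaloisGroup K) (k : ℕ)
      [Fact (ZpExtension.IsTopGeneratorPair κ₁ κ₂ γ₁ γ₂)],
    (∀ v : HeightOneSpectrum (𝓞 K), v ≠ 𝔭 → ∀ 𝔓 ∈ v.primesAbove,
        𝔓.inertia (Field.absoluteGaloisGroup K) ≤ κ₁.kerSubgroup) →
    ZpExtension.pairKer κ₁ κ₂ ≤ κ.kerSubgroup → γ₁ * γ⁻¹ ∈ κ.kerSubgroup → γ₂ * (γ ^ (3 ^ k))⁻¹ ∈ κ.kerSubgroup →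
    ∃ (ΩK' : ℂ) (Ωp' : ℂ_[3]) (L₂ : PowerSeries (PowerSeries (unrIntegers 3))),
      ΩK' ≠ 0 ∧ Ωp' ≠ 0 ∧ IsToricTwoVarLFunction ι' 𝔭 𝔭' κ₁ κ₂ γ₁ γ₂ Dt.f ΩK' Ωp' L₂ := by
  sorry

/-- **E₂ `stub_twoVarEisenstein`** (crux-research ∀, XL — UNDECIDED, incomparable with the crux; SHARED ENGINE with SOED
`WildSplitEisensteinInclusionAtThree` (stmt-BirchSwinnertonDyer-20479), of which it is the native two-variable form): in a v2
frame, for every non-zero toric two-variable function `L₂` PINNED by `IsToricTwoVarLFunction` and every generator `g` of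
`char_{Λ₂} X₂` (`X₂ = X_{∅ at 𝔭, nr at 𝔭′}(E/K̃_∞)`, finitely generated and torsion), the EISENSTEIN (lower-bound) divisibility
`L₂ ∣ G` holds in `Λ₂(R₀)`, `G` the image of `g`.  Mechanism: Klingen–Eisenstein congruences on `U(3,1)` for the
semi-ordinary family `f_E ⊗ 𝛉(CM Hida family of K)` — only the CM variable is ordinary, `f_E` is FIXED (Wan 2015/2020;
BCS24 eq. (1.1)–(1.2), (5.5)); `μ`-part from Hsieh 2014 / Burungale 2017 (`μ(L₂) = 0`).
[cite: BurungaleCastellaSkinner2024, §1.5 eq. (1.1)–(1.2), §5.2 eq. (5.5) (arXiv:2405.00270 store p0005, p0010–p0011)]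
Why it might fail: the `p`-integral local Fourier–Jacobi / doubling computation at a SUPERCUSPIDAL `π_{f,3}` with `3² ∣ N`
is unwritten (SOED's why-might-fail), and Wan15's `p > 3` enters «only for a comparison of certain automorphic periods»
(BCS24 p. 5) — at `p = 3` that comparison is the open point; the `μ`-part needs `μ(L₂) = 0` for the toric function of the
additive curve (Hsieh's hypotheses at `p = 3`). -/
theorem stub_twoVarEisenstein :
    ∀ (W : WeierstrassCurve ℚ) [W.IsElliptic] [W.IsGloballyMinimal] (N : ℕ) [NeZero N] (K : Type) [Field K]
      [NumberField K] (Dt : Literature.NumberTheory.EllipticCurves.ModularForms.ModularParametrizationData W N),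
    Summit.BirchSwinnertonDyer.Rank1Residual.Additive.ClassO6 W 3 → W.HasSurjectiveModNGaloisRep 3 →
    W.analyticRank = 1 → W.conductorNorm ℤ = N → IsImaginaryQuadratic K → SatisfiesHeegnerHypothesis N K →
    ∀ (𝔭 : HeightOneSpectrum (𝓞 K)), ((3 : ℕ) : 𝓞 K) ∈ 𝔭.asIdeal →
      𝔭.asIdeal.ramificationIdx (𝓞 ℚ) = 1 → 𝔭.asIdeal.inertiaDeg (𝓞 ℚ) = 1 →
    ∀ (𝔭' : HeightOneSpectrum (𝓞 K)), ((3 : ℕ) : 𝓞 K) ∈ 𝔭'.asIdeal → 𝔭' ≠ 𝔭 →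
    ∀ (ι' : PadicAlgCl 3 ≃+* ℂ), Summit.BirchSwinnertonDyer.BirchSwinnertonDyer.Theorems.SchneiderFree.BranchInducesPrime 3 ι' 𝔭 →
    ∀ (κ₁ κ₂ : ZpExtension K 3) (γ₁ γ₂ : Field.absoluteGaloisGroup K)
      [Fact (ZpExtension.IsTopGeneratorPair κ₁ κ₂ γ₁ γ₂)],
    (∀ v : HeightOneSpectrum (𝓞 K), v ≠ 𝔭 → ∀ 𝔓 ∈ v.primesAbove,
        𝔓.inertia (Field.absoluteGaloisGroup K) ≤ κ₁.kerSubgroup) →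
    Module.Finite (IwasawaAlgebra₂ 3) ((W.baseChange K).XGr₂ 3 κ₁ κ₂ 𝔭' γ₁ γ₂) →
    Module.IsTorsion (IwasawaAlgebra₂ 3) ((W.baseChange K).XGr₂ 3 κ₁ κ₂ 𝔭' γ₁ γ₂) →
    ∀ (g : IwasawaAlgebra₂ 3),
      Literature.NumberTheory.EllipticCurves.Module.charIdeal (IwasawaAlgebra₂ 3)
        ((W.baseChange K).XGr₂ 3 κ₁ κ₂ 𝔭' γ₁ γ₂) = Ideal.span {g} →
    ∀ (ΩK : ℂ) (Ωp : ℂ_[3]) (L₂ : PowerSeries (PowerSeries (unrIntegers 3))), ΩK ≠ 0 → Ωp ≠ 0 →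
      IsToricTwoVarLFunction ι' 𝔭 𝔭' κ₁ κ₂ γ₁ γ₂ Dt.f ΩK Ωp L₂ → L₂ ≠ 0 →
    L₂ ∣ PowerSeries.map (PowerSeries.map (Summit.BirchSwinnertonDyer.Rank1Residual.X11b.Halves.toUnr 3)) g := by
  sorry

/-- **A `stub_cyclotomicAnchor`** (crux-research ∃, XL — UNDECIDED, incomparable with the crux, WEAKER than the two-variable
IMC): in a v2 frame, for every non-zero PINNED `L₂` and generator `g` of `char_{Λ₂} X₂` (f.g. torsion), there is a proper,
NON-ZERO ideal `𝔮 ⊂ Λ₂(R₀)` such that `L₂ mod 𝔮` is a non-zero-divisor of `Λ₂(R₀)/𝔮` and `G ≡ L₂` up to a unit of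
`Λ₂(R₀)/𝔮`.  INTENDED WITNESS `𝔮 = 𝔠`, the CYCLOTOMIC LINE of the frame (kernel of `Λ₂(R₀) ↠ R₀⟦Γ_cyc⟧`; for odd `p` the
frame splits `Γ_K = Γ⁺ × Γ⁻` exactly): there (A-Kato) Kato's divisibility `char X(f/ℚ_cyc) ∣ …` for `f_E` and `f_E ⊗ ε_K`
[Kato 2004 Thm. 12.5 (4)/17.4; integral for 3-adically big image], (A-PT) the Poitou–Tate four-term sequences converting the
pair of Kato main conjectures into the `(∅ at 𝔭, nr at 𝔭′)` one on `K_cyc` (BSTW23 §9.3.2 / CGS23 Prop. 3.2.1 shape), (A-ctrl)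
control `X₂/𝔠X₂ ↠ X_{∅,nr}(E/K_cyc)` with pseudo-null kernel, and (A-ε) the IDENTITY (I)
`π_𝔠(L₂) ∼ ε_{3}(loc₃ z_Kato(f_E) ∧ loc₃ z_Kato(f_E ⊗ ε_K))` in `R₀⟦Γ_cyc⟧` (Nakamura's rank-two local ε-isomorphism;
ORDINARY analogue in print: `π⁺(L^{PR}_p(g/K)) = L_p(g)·L_p(g^K)`, CGS23 Prop. 1.2.4 as used in BCS24 eq. (5.3)) give
`Ḡ ∣ L̄₂`, which with E₂ is association mod `𝔠` (proof of `associated_of_dvd_of_anchor` run inside the quotient).  Only the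
ONE-SIDED Kato direction is needed on the line.  Equality instead of Kato-divisibility is Fouquet–Wan Thm. 1.7 at `p = 3`
(arXiv:2107.13726, supercuspidal allowed) — not required.  Degenerate admissible witnesses (documented, not the intent): any
height-one `𝔮 ∌ L₂` once the two-variable IMC is known; a residual `𝔮 ∋ 3` = two-variable twin transport (equivalent to the
landed SOED ⟷ wall interchange, NOT new).  `𝔮 = ⊥` is excluded (it would restate the two-variable IMC).
[cite: BurungaleCastellaSkinner2024, §5.2 proof of Thm. 1.1.2, eq. (5.3)–(5.4) (arXiv:2405.00270 store p0010)]
[cite: FouquetWan2021, Thm. 1.7 + Remark after Thm. 3.6 (arXiv:2107.13726 store p0005, p0020)]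
Why it might fail: (I) at a supercuspidal `3` is a new explicit-reciprocity identity on the cyclotomic tower for a
potentially-crystalline, non-trianguline `V_f|G_{ℚ₃}` (Bloch–Kato logarithms of Kato classes at finite-order twists vs. the
out-of-range values of Hida's toric measure) — beyond print; and Kato's INTEGRAL divisibility at `p = 3` needs the 3-adic
image to contain `SL₂(ℤ₃)` (mod-3 surjectivity does not imply it: the onto-mod-3-not-mod-9 rows are a residual). -/
theorem stub_cyclotomicAnchor :
    ∀ (W : WeierstrassCurve ℚ) [W.IsElliptic] [W.IsGloballyMinimal] (N : ℕ) [NeZero N] (K : Type) [Field K]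
      [NumberField K] (Dt : Literature.NumberTheory.EllipticCurves.ModularForms.ModularParametrizationData W N),
    Summit.BirchSwinnertonDyer.Rank1Residual.Additive.ClassO6 W 3 → W.HasSurjectiveModNGaloisRep 3 →
    W.analyticRank = 1 → W.conductorNorm ℤ = N → IsImaginaryQuadratic K → SatisfiesHeegnerHypothesis N K →
    ∀ (𝔭 : HeightOneSpectrum (𝓞 K)), ((3 : ℕ) : 𝓞 K) ∈ 𝔭.asIdeal →
      𝔭.asIdeal.ramificationIdx (𝓞 ℚ) = 1 → 𝔭.asIdeal.inertiaDeg (𝓞 ℚ) = 1 →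
    ∀ (𝔭' : HeightOneSpectrum (𝓞 K)), ((3 : ℕ) : 𝓞 K) ∈ 𝔭'.asIdeal → 𝔭' ≠ 𝔭 →
    ∀ (ι' : PadicAlgCl 3 ≃+* ℂ), Summit.BirchSwinnertonDyer.BirchSwinnertonDyer.Theorems.SchneiderFree.BranchInducesPrime 3 ι' 𝔭 →
    ∀ (κ₁ κ₂ : ZpExtension K 3) (γ₁ γ₂ : Field.absoluteGaloisGroup K)
      [Fact (ZpExtension.IsTopGeneratorPair κ₁ κ₂ γ₁ γ₂)],
    (∀ v : HeightOneSpectrum (𝓞 K), v ≠ 𝔭 → ∀ 𝔓 ∈ v.primesAbove,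
        𝔓.inertia (Field.absoluteGaloisGroup K) ≤ κ₁.kerSubgroup) →
    Module.Finite (IwasawaAlgebra₂ 3) ((W.baseChange K).XGr₂ 3 κ₁ κ₂ 𝔭' γ₁ γ₂) →
    Module.IsTorsion (IwasawaAlgebra₂ 3) ((W.baseChange K).XGr₂ 3 κ₁ κ₂ 𝔭' γ₁ γ₂) →
    ∀ (g : IwasawaAlgebra₂ 3),
      Literature.NumberTheory.EllipticCurves.Module.charIdeal (IwasawaAlgebra₂ 3)
        ((W.baseChange K).XGr₂ 3 κ₁ κ₂ 𝔭' γ₁ γ₂) = Ideal.span {g} →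
    ∀ (ΩK : ℂ) (Ωp : ℂ_[3]) (L₂ : PowerSeries (PowerSeries (unrIntegers 3))), ΩK ≠ 0 → Ωp ≠ 0 →
      IsToricTwoVarLFunction ι' 𝔭 𝔭' κ₁ κ₂ γ₁ γ₂ Dt.f ΩK Ωp L₂ → L₂ ≠ 0 →
    ∃ 𝔮 : Ideal (PowerSeries (PowerSeries (unrIntegers 3))), 𝔮 ≠ ⊥ ∧ 𝔮 ≠ ⊤ ∧
      Ideal.Quotient.mk 𝔮 L₂ ∈ nonZeroDivisors (PowerSeries (PowerSeries (unrIntegers 3)) ⧸ 𝔮) ∧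
      Associated
        (Ideal.Quotient.mk 𝔮
          (PowerSeries.map (PowerSeries.map (Summit.BirchSwinnertonDyer.Rank1Residual.X11b.Halves.toUnr 3)) g))
        (Ideal.Quotient.mk 𝔮 L₂) := by
  sorry

/-- **stub_noPseudoNull** — VERBATIM from `Lines/thin_comb.lean` v8.1 (WEAKER · ATTACKABLE; closed in tree modulo the one
textbook fact `GaloisCohomology.poitouTate_shaRestricted_tateDual_natural_at`, see
`Theorems/UniversalToricDescentThinCombNoPseudoNullOfPoitouTate.lean`): every pseudo-null `Λ₂`-submodule of the f.g.
torsion `X₂` is finite. [cite: Greenberg2016, Prop. 4.1.1] -/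
theorem stub_noPseudoNull :
    ∀ (W : WeierstrassCurve ℚ) [W.IsElliptic] [W.IsGloballyMinimal] (K : Type) [Field K] [NumberField K],
    Summit.BirchSwinnertonDyer.Rank1Residual.Additive.ClassO6 W 3 → W.HasSurjectiveModNGaloisRep 3 →
    IsImaginaryQuadratic K →
    ∀ (κ : ZpExtension K 3), κ.IsAnticyclotomic → ∀ (γ : Field.absoluteGaloisGroup K) [Fact (κ.IsTopGenerator γ)]
      (𝔭 : HeightOneSpectrum (𝓞 K)), ((3 : ℕ) : 𝓞 K) ∈ 𝔭.asIdeal →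
    ∀ (𝔭' : HeightOneSpectrum (𝓞 K)), ((3 : ℕ) : 𝓞 K) ∈ 𝔭'.asIdeal → 𝔭' ≠ 𝔭 →
    ∀ (κ₁ κ₂ : ZpExtension K 3) (γ₁ γ₂ : Field.absoluteGaloisGroup K) (k : ℕ)
      [Fact (ZpExtension.IsTopGeneratorPair κ₁ κ₂ γ₁ γ₂)],
    (∀ v : HeightOneSpectrum (𝓞 K), v ≠ 𝔭 → ∀ 𝔓 ∈ v.primesAbove,
        𝔓.inertia (Field.absoluteGaloisGroup K) ≤ κ₁.kerSubgroup) →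
    ZpExtension.pairKer κ₁ κ₂ ≤ κ.kerSubgroup → γ₁ * γ⁻¹ ∈ κ.kerSubgroup → γ₂ * (γ ^ (3 ^ k))⁻¹ ∈ κ.kerSubgroup →
    Module.Finite (IwasawaAlgebra₂ 3) ((W.baseChange K).XGr₂ 3 κ₁ κ₂ 𝔭' γ₁ γ₂) →
    Module.IsTorsion (IwasawaAlgebra₂ 3) ((W.baseChange K).XGr₂ 3 κ₁ κ₂ 𝔭' γ₁ γ₂) →
    ∀ N : Submodule (IwasawaAlgebra₂ 3) ((W.baseChange K).XGr₂ 3 κ₁ κ₂ 𝔭' γ₁ γ₂),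
      Literature.NumberTheory.EllipticCurves.Module.IsPseudoNull (IwasawaAlgebra₂ 3) N → Finite N := by
  sorry

/-! ## Composition -/

/-- **Composition** (kernel-checked, no `sorry` outside the four stubs): the `thin_comb` v8.1 frame (landed `stub_frame`,
`stub_charIdealPrincipal`, `xGr₂_module_finite`, `ContRigidity.eq_zero_or_span_spec_eq_of_toric`, `stub_torsionTransfer`,
`span_le_map_charIdeal_of_not_isTorsion`, `LineValue.sub_one_mul_map_spec_mem_lineIdeal`, `stub_descent` — all BY NAME),
K3a, E₂, the anchor A and the PROVED Nakayama step `dvd_of_dvd_of_anchor` give the crux BY NAME. -/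
theorem AdditiveSplitIMCInclusionAtThree_of :
    Summit.BirchSwinnertonDyer.BirchSwinnertonDyer.Theses.UniversalToricDescent.AdditiveSplitIMCInclusionAtThree := by
  intro W _ _ N _ K _ _ Dt hO6 hsurj hrk hN hK hH κ hκ γ hγ 𝔭 h3 hram hdeg 𝔭' h3' hne ι' hι ΩK Ωp L hΩK hΩp hL
  obtain ⟨κ₁, κ₂, γ₁, γ₂, k, hpair, hur₁, hker, hγ₁, hγ₂⟩ :=
    Summit.BirchSwinnertonDyer.BirchSwinnertonDyer.Theorems.UniversalToricDescentThinCombLine.stub_frame K hK κ hκ γ hγ.out 𝔭 h3 𝔭' h3' hne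
  haveI : Fact (ZpExtension.IsTopGeneratorPair κ₁ κ₂ γ₁ γ₂) := ⟨hpair⟩
  obtain ⟨g, hg⟩ :=
    (Summit.BirchSwinnertonDyer.BirchSwinnertonDyer.Theorems.UniversalToricDescentThinCombLine.stub_charIdealPrincipal ((W.baseChange K).XGr₂ 3 κ₁ κ₂ 𝔭' γ₁ γ₂))
  have hg' : Literature.NumberTheory.EllipticCurves.Module.charIdeal (IwasawaAlgebra₂ 3)
      ((W.baseChange K).XGr₂ 3 κ₁ κ₂ 𝔭' γ₁ γ₂) = Ideal.span {g} := by
    simpa [Ideal.submodule_span_eq] using hg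
  have hfin : Module.Finite (IwasawaAlgebra₂ 3) ((W.baseChange K).XGr₂ 3 κ₁ κ₂ 𝔭' γ₁ γ₂) :=
    Summit.BirchSwinnertonDyer.BirchSwinnertonDyer.Theorems.SignedBaseChangeAcDivFinitePiece.xGr₂_module_finite
      (W.baseChange K) 3 κ₁ κ₂ 𝔭'
  -- K3a: a toric two-variable function at some period pair
  obtain ⟨ΩK', Ωp', L₂, hΩK', hΩp', hL₂⟩ :=
    stub_toricExists W N K Dt hO6 hsurj hrk hN hK hH κ hκ γ 𝔭 h3 hram hdeg 𝔭' h3' hne ι' hι κ₁ κ₂ γ₁ γ₂ k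
      hur₁ hker hγ₁ hγ₂
  -- cross-period rigidity: `L = 0` or `(spec L₂) = (L)`
  rcases Summit.BirchSwinnertonDyer.BirchSwinnertonDyer.Theorems.UniversalToricDescentThinComb.ContRigidity.eq_zero_or_span_spec_eq_of_toric
      K N Dt.f hK κ hκ γ hγ.out 𝔭 h3 𝔭' h3' hne ι' κ₁ κ₂ γ₁ γ₂ k hpair hγ₁ hγ₂ hΩK hΩp hL hΩK' hΩp' hL₂ with h0 | hspan
  · rw [h0, Ideal.span_singleton_eq_bot.mpr rfl]
    exact bot_le
  -- the zero toric function: the central-ray restriction is `0`, the inclusion is trivial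
  by_cases hL0 : L₂ = 0
  · rw [← hspan, hL0, map_zero, Ideal.span_singleton_eq_bot.mpr rfl]
    exact bot_le
  -- TORSION DICHOTOMY: off the torsion locus of `X₂` the inclusion is vacuous
  by_cases htors : Module.IsTorsion (IwasawaAlgebra₂ 3) ((W.baseChange K).XGr₂ 3 κ₁ κ₂ 𝔭' γ₁ γ₂)
  swap
  · have hnt := Summit.BirchSwinnertonDyer.BirchSwinnertonDyer.Theorems.UniversalToricDescentThinCombLine.stub_torsionTransfer
      W K hO6 hsurj hK κ hκ γ 𝔭 h3 𝔭' h3' hne κ₁ κ₂ γ₁ γ₂ k hur₁ hker hγ₁ hγ₂ htors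
    exact Summit.BirchSwinnertonDyer.BirchSwinnertonDyer.Theorems.UniversalToricDescentCharIdealVacuity.span_le_map_charIdeal_of_not_isTorsion
      hnt _ L
  have hcong : ∃ u : (PowerSeries (PowerSeries (unrIntegers 3)))ˣ,
      L₂ - u * PowerSeries.map (PowerSeries.C (R := unrIntegers 3)) (TwoVarSubst.spec (3 ^ k) L₂) ∈
        Ideal.span {T₂ (unrIntegers 3) - ((1 + T₁ (unrIntegers 3)) ^ (3 ^ k) - 1)} :=
    ⟨1, LineValue.sub_one_mul_map_spec_mem_lineIdeal (3 ^ k) L₂⟩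
  -- E₂: the Eisenstein (lower-bound) divisibility in the family
  have hE := stub_twoVarEisenstein W N K Dt hO6 hsurj hrk hN hK hH 𝔭 h3 hram hdeg 𝔭' h3' hne ι' hι κ₁ κ₂ γ₁ γ₂
      hur₁ hfin htors g hg' ΩK' Ωp' L₂ hΩK' hΩp' hL₂ hL0
  -- A: association on ONE proper non-zero quotient (intended: the cyclotomic line)
  obtain ⟨𝔮, -, h𝔮, hreg, hA⟩ := stub_cyclotomicAnchor W N K Dt hO6 hsurj hrk hN hK hH 𝔭 h3 hram hdeg 𝔭' h3' hne ι' hι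
      κ₁ κ₂ γ₁ γ₂ hur₁ hfin htors g hg' ΩK' Ωp' L₂ hΩK' hΩp' hL₂ hL0
  -- Nakayama in the local ring `Λ₂(R₀) = R₀⟦T₂⟧⟦T₁⟧`: the quotient `G/L₂` is a unit
  haveI := Summit.BirchSwinnertonDyer.Rank1Residual.X2.HidaLimitAlgebra.isDiscreteValuationRing_unrIntegers (p := 3)
  have hdvd : PowerSeries.map (PowerSeries.map (Summit.BirchSwinnertonDyer.Rank1Residual.X11b.Halves.toUnr 3)) g ∣ L₂ :=
    dvd_of_dvd_of_anchor h𝔮 hE hreg hA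
  have hPN := stub_noPseudoNull W K hO6 hsurj hK κ hκ γ 𝔭 h3 𝔭' h3' hne κ₁ κ₂ γ₁ γ₂ k hur₁ hker hγ₁ hγ₂
    hfin htors
  rw [← hspan]
  exact Summit.BirchSwinnertonDyer.BirchSwinnertonDyer.Theorems.UniversalToricDescentThinCombLine.stub_descent W K hO6 hsurj hK κ hκ γ 𝔭 h3 𝔭' h3' hne κ₁ κ₂ γ₁ γ₂ k hur₁ hker
    hγ₁ hγ₂ hfin htors hPN
    g hg' L₂ (TwoVarSubst.spec (3 ^ k) L₂) hdvd hcong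

end Summit.BirchSwinnertonDyer.BirchSwinnertonDyer.Cruxes.AdditiveSplitIMCInclusionAtThree.NakayamaAnchor

end
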